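import Mathlib
import Summits.Ventures.HodgeRepro.Tier4.Common.KTypeSpace
import Summits.Ventures.HodgeRepro.Tier4.Common.SettingOfData
import Summits.Ventures.HodgeRepro.Tier4.Common.MixedPlaneCusp
import Summits.Ventures.HodgeRepro.Tier4.Line4.AdaptedONBConj
import Summits.Ventures.HodgeRepro.Tier4.Line4.ConjSpanLemmas
import Summits.Ventures.HodgeRepro.Tier4.Line4.ThetaRungs
import Summits.Ventures.HodgeRepro.Tier4.Line1.PlaneDefs

/-!
# Tier4/Line4/AdmissibleOfONB — C-L4-ADM135: admissibility of a constituent is only its four `K`-type conjuncts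

Blind re-derivation cell `pub-hodge-repro`, Tier 4 «prove the step» (README §9–§10), seat t4-L4-p2 (prover, LINE L4,
gen 3; plan-4 g3's cut S14337, statements VERBATIM from proofs/t4-plan-4/work/AdmissibleOfONB-STATEMENTS.lean
4cff45567c21eb56 — only this header replaced). Tree path `lean/Summits/Ventures/HodgeRepro/Tier4/Line4/AdmissibleOfONB.lean`.
Mathlib-level; no literature. Inputs: L4-p1's `AdaptedONBConj` (`isInvariantSubspace_conj`, `isIrreducible_conj`),
`ConjSpanLemmas` (`coe_span_eq_of_isInvariantSubspace`), `ThetaRungs` (`isCuspidalSubspace_of_isAnisotropic`), L1's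
`PlaneDefs` (`IsDefinite`), typer-2's `MixedPlaneCusp` (`IsAnisotropic`) and `KTypeSpace` (`IsAdmissibleS`).

For `V m := span ℂ (conj '' τ m)` (W3TwoVector's displayed constituent) and an adapted ONB `(τ, φ, n)` of the setting:
(1) `V m` is an invariant subspace, (2) irreducible (the conjugate of `τ m` through `AdaptedONBConj`, the span being
the set itself when `τ m` is non-empty, and `{0}` — trivially invariant and irreducible — when it is empty), (3) a
DEFINITE plane is anisotropic (`σ (ℓ ⬝ B ℓ) = (σ ∘ ℓ) ⬝ (B.map σ)(σ ∘ ℓ)`, which is `≠ 0` by positive or negative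
definiteness), hence every `V` is cuspidal (`ThetaRungs`); (4) **`IsAdmissibleS … (V m)` is exactly the four `K`-type
conjuncts** (4)–(7) — (4)/(6) read off non-zero periods, (5)/(7) the pseudo-coefficient display — the conjuncts
(1)–(3) being free.  Junk row (plan-4 S14337): `τ m = ∅` ⇒ `V m = ⊥`, (1)(2) hold, (4) asks the `K`-types of `{0}`,
which `HasKTypeAt` (a non-zero vector) refuses — no vacuity in the consumer (`m = n j`, `φ j ∈ τ (n j)`).

Nothing here says anything about the status of the Hodge conjecture for CM abelian varieties, which is NOT proved
(HC_CM is NOT proved by anyone in this repository).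
-/

set_option autoImplicit false
noncomputable section
namespace Summit.Ventures.HodgeRepro.Tier4.Line4
open Summit.Ventures.HodgeRepro.Tier4.Common Summit.Ventures.HodgeRepro.Tier4.Line1 MeasureTheory NumberField
open scoped ComplexConjugate


section Zero

variable {G : Type} [Group G] [TopologicalSpace G] [IsTopologicalGroup G] [MeasurableSpace G] [BorelSpace G]
  (S : RTF.Setting G)

omit [IsTopologicalGroup G] [BorelSpace G] in
/-- `{0}` is an invariant subspace of any setting. -/
theorem isInvariantSubspace_singleton_zero : S.IsInvariantSubspace ({0} : Set (G → ℂ)) := by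
  refine ⟨?_, ?_, ?_, ?_, ?_, ?_⟩
  · intro φ hφ
    rw [Set.mem_singleton_iff] at hφ
    subst hφ
    intro γ x
    rfl
  · intro φ hφ
    rw [Set.mem_singleton_iff] at hφ
    subst hφ
    exact continuous_const
  · intro φ hφ g
    rw [Set.mem_singleton_iff] at hφ
    subst hφ
    rfl
  · intro φ hφ ψ hψ
    rw [Set.mem_singleton_iff] at hφ hψ
    subst hφ hψ
    rw [Set.mem_singleton_iff]
    funext x
    simp
  · intro φ hφ c
    rw [Set.mem_singleton_iff] at hφ
    subst hφ
    rw [Set.mem_singleton_iff]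
    funext x
    simp
  · intro φ hφ f _
    rw [Set.mem_singleton_iff] at hφ
    subst hφ
    rw [Set.mem_singleton_iff]
    funext x
    simp [RTF.Setting.R]

omit [IsTopologicalGroup G] [BorelSpace G] in
/-- `{0}` is irreducible (its only invariant subspace is zero). -/
theorem isIrreducible_singleton_zero : S.IsIrreducible ({0} : Set (G → ℂ)) := by
  intro V' _ hsub
  left
  intro ψ hψ x
  have := hsub hψ
  rw [Set.mem_singleton_iff] at this
  rw [this]
  rfl

end Zero

variable {k : Type} [Field k] [NumberField k] (W : PlaneData k) [MeasurableSpace (GA W)] [BorelSpace (GA W)]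
  (R : RTFData W) (μ : Measure (GA W)) [μ.IsHaarMeasure] [R.μT.IsHaarMeasure] [R.μT'.IsHaarMeasure]
  (DG : Set (GA W)) (fdG : IsFundamentalDomain (rationalPoints W) DG μ) (compG : IsCompact (closure DG))
  (compT : IsCompact (closure R.DT)) (compT' : IsCompact (closure R.DT'))

/-- **(1) invariance of the conjugate constituent, on the span** (cut C-L4-ADM135 (1)): for an adapted ONB the set
`↑(span ℂ (conj '' τ m))` is an invariant subspace (`isInvariantSubspace_conj` + `coe_span_eq_of_isInvariantSubspace`). -/
theorem isInvariantSubspace_span_conj_of_adapted {τ : ℕ → Set (GA W → ℂ)} {φ : ℕ → GA W → ℂ} {n : ℕ → ℕ}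
    (hB : (Setting.ofAdelicData W R μ DG fdG compG compT compT').IsAdaptedONB τ φ n) (m : ℕ) :
    (Setting.ofAdelicData W R μ DG fdG compG compT compT').IsInvariantSubspace
      ((Submodule.span ℂ ((fun ψ : GA W → ℂ => fun x => conj (ψ x)) '' τ m) : Submodule ℂ (GA W → ℂ)) :
        Set (GA W → ℂ)) := by
  set S := Setting.ofAdelicData W R μ DG fdG compG compT compT' with hS
  by_cases hne : (τ m).Nonempty
  · rw [coe_span_eq_of_isInvariantSubspace S (isInvariantSubspace_conj S (hB.inv m)) (hne.image _)]
    exact isInvariantSubspace_conj S (hB.inv m)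
  · rw [Set.not_nonempty_iff_eq_empty] at hne
    rw [hne, Set.image_empty, Submodule.span_empty, Submodule.bot_coe]
    exact isInvariantSubspace_singleton_zero S

/-- **(2) irreducibility of the conjugate constituent, on the span** (cut C-L4-ADM135 (2)). -/
theorem isIrreducible_span_conj_of_adapted {τ : ℕ → Set (GA W → ℂ)} {φ : ℕ → GA W → ℂ} {n : ℕ → ℕ}
    (hB : (Setting.ofAdelicData W R μ DG fdG compG compT compT').IsAdaptedONB τ φ n) (m : ℕ) :
    (Setting.ofAdelicData W R μ DG fdG compG compT compT').IsIrreducible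
      ((Submodule.span ℂ ((fun ψ : GA W → ℂ => fun x => conj (ψ x)) '' τ m) : Submodule ℂ (GA W → ℂ)) :
        Set (GA W → ℂ)) := by
  set S := Setting.ofAdelicData W R μ DG fdG compG compT compT' with hS
  by_cases hne : (τ m).Nonempty
  · rw [coe_span_eq_of_isInvariantSubspace S (isInvariantSubspace_conj S (hB.inv m)) (hne.image _)]
    exact isIrreducible_conj S (hB.irred m)
  · rw [Set.not_nonempty_iff_eq_empty] at hne
    rw [hne, Set.image_empty, Submodule.span_empty, Submodule.bot_coe]
    exact isIrreducible_singleton_zero S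

omit [NumberField k] [MeasurableSpace (GA W)] [BorelSpace (GA W)] in
/-- **(3) anisotropy from definiteness** (cut C-L4-ADM135 (3)): a definite plane has no isotropic vector. -/
theorem isAnisotropic_of_isDefinite (hW : Line1.IsDefinite W) : IsAnisotropic W := by
  rintro ⟨ℓ, hℓ, hiso⟩
  obtain ⟨σ, hσ⟩ := hW
  have hℓ' : (σ ∘ ℓ : Fin 4 → ℝ) ≠ 0 := by
    intro h
    apply hℓ
    funext i
    have hi := congrFun h i
    simp only [Function.comp_apply, Pi.zero_apply] at hi
    exact (map_eq_zero σ).1 hi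
  have key : σ (dotProduct ℓ (Matrix.mulVec W.B ℓ)) = dotProduct (σ ∘ ℓ) (Matrix.mulVec (W.B.map σ) (σ ∘ ℓ)) := by
    rw [RingHom.map_dotProduct]
    congr 1
    funext i
    exact RingHom.map_mulVec σ W.B ℓ i
  rw [hiso, map_zero] at key
  rcases hσ with hpos | hneg
  · have := hpos.dotProduct_mulVec_pos hℓ'
    rw [star_trivial, ← key] at this
    exact lt_irrefl _ this
  · have := hneg.dotProduct_mulVec_pos hℓ'
    rw [star_trivial, Matrix.neg_mulVec, dotProduct_neg, ← key, neg_zero] at this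
    exact lt_irrefl _ this

/-- **ASSEMBLY OF `IsAdmissibleS` ON A CONSTITUENT** (cut C-L4-ADM135 (4)): for an adapted ONB of a DEFINITE plane,
conjuncts (1) invariance, (2) irreducibility, (3) cuspidality of `span ℂ (conj '' τ m)` are free, so admissibility is
exactly the four `K`-type conjuncts (4)–(7) — (4)/(6) read off non-zero periods (`KTypeOfPeriod(Primed)`), (5)/(7) the
pseudo-coefficient display. -/
theorem isAdmissibleS_span_conj_of_kTypes (hW : Line1.IsDefinite W)
    {τ : ℕ → Set (GA W → ℂ)} {φ : ℕ → GA W → ℂ} {n : ℕ → ℕ}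
    (hB : (Setting.ofAdelicData W R μ DG fdG compG compT compT').IsAdaptedONB τ φ n) (m : ℕ)
    (q : QuadData k) (g g' : Matrix (Fin 4) (Fin 4) k) (w₀ : InfinitePlace k)
    (eP eM eP' eM' : InfinitePlace k → ℤ)
    (h4 : ∀ w, HasKTypeAt W q w (eP w) (eM w)
      (Submodule.span ℂ ((fun ψ : GA W → ℂ => fun x => conj (ψ x)) '' τ m)))
    (h5 : ∀ j : ℤ, |(eP w₀ - eM w₀) + 2 * j| < 3 → ¬ HasKTypeAt W q w₀ (eP w₀ + j) (eM w₀ - j)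
      (Submodule.span ℂ ((fun ψ : GA W → ℂ => fun x => conj (ψ x)) '' τ m)))
    (h6 : ∀ w, HasKTypeAt' W q w g g' (eP' w) (eM' w)
      (Submodule.span ℂ ((fun ψ : GA W → ℂ => fun x => conj (ψ x)) '' τ m)))
    (h7 : ∀ j : ℤ, |(eP' w₀ - eM' w₀) + 2 * j| < 3 → ¬ HasKTypeAt' W q w₀ g g' (eP' w₀ + j) (eM' w₀ - j)
      (Submodule.span ℂ ((fun ψ : GA W → ℂ => fun x => conj (ψ x)) '' τ m))) :
    IsAdmissibleS W (Setting.ofAdelicData W R μ DG fdG compG compT compT') q g g' w₀ eP eM eP' eM'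
      (Submodule.span ℂ ((fun ψ : GA W → ℂ => fun x => conj (ψ x)) '' τ m)) :=
  ⟨isInvariantSubspace_span_conj_of_adapted W R μ DG fdG compG compT compT' hB m,
    isIrreducible_span_conj_of_adapted W R μ DG fdG compG compT compT' hB m,
    isCuspidalSubspace_of_isAnisotropic (isAnisotropic_of_isDefinite W hW) _, h4, h5, h6, h7⟩

end Summit.Ventures.HodgeRepro.Tier4.Line4
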